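import Summits.Ventures.Crystal3D.Theorems.StickyWulffConstantNoReconstructionGainGrainAdhesion
import Summits.Ventures.Crystal3D.Theorems.StickyWulffConstantNoReconstructionGainSampleDeficit
import Summits.Ventures.Crystal3D.Theorems.StickyWulffConstantNoReconstructionGainSteepFlatNoGain
import Summits.Ventures.Crystal3D.StickySpheres.FinsetBridge
import HarnessLib

/-!
# No reconstruction gain at `(111)` for misoriented Barlow grains — the crux's vocabulary

HONEST FRAMING. Part of the venture `Summits/Ventures/Crystal3D` (cell `crystal3d-full`), helper
`--supports` the crux `NoReconstructionGain` (stmt-Ventures-19144, route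
`route-Ventures-StickyWulffConstant`), line `adhesion`.  The GRAIN RUNG `barlowGrainAdhesion111`
(`…GrainAdhesion`) composed with the lattice bookkeeping of the line (`stub_sampleDeficit`,
`contactDeficiency_sdiff_split`, `contactDeficiency_image_eq`) gives the inner statement of the
crux at the unit normal `ν = e₃` — with the crux's inlined surface tension
`φ(ν) = (√2/4) Σᶠ_{w ∈ Λ₀, ‖w‖ = 1} |⟪w, ν⟫|` and slab sample
`{p ∈ Λ₀ : −2R ≤ ⟪p, ν⟫ ≤ −R, ‖p‖² − ⟪p, ν⟫² ≤ ρ²}` — for every unit packing `x` of `N` balls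
containing the sample whose other balls all lie in ONE rigid-motion image of SOME Barlow stacking:
`2 φ(e₃) π ρ² − C ρ ≤ 6N − numContacts x` (`barlowGrain_noReconstructionGain_single_two`,
`R = 4`, `C = (1020 + 60√2) π`), i.e. `2√3 π ρ² − Cρ ≤ 6N − C(x)` (`…_sqrt3`).
No misoriented grain — fcc, hcp, any polytype, twinned, of any shape and tilt, glued in any
position onto the flat `(111)` facet — lowers the deficiency below the two free faces.

WHAT THIS IS NOT: the crux (`ν` arbitrary, overlayer arbitrary); rung F-C1 not moved.
-/

noncomputable section

namespace Summit.Ventures.Crystal3D.Theorems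

open Summit.Ventures.Crystal3D Finset Real
open Literature.MathematicalPhysics.StatisticalMechanics (barlowStacking fccStacking IsHaggSeq
  contactDeficiency)
open scoped InnerProductSpace

/-- **The grain rung in the crux's vocabulary (`ν = e₃`).**  With `R = 4`,
`C = (1020 + 60√2) π`: for `ρ ≥ R`, every unit packing `x : Fin N → ℝ³` that contains the slab
sample `{p ∈ Λ₀ : −2R ≤ ⟪p, e₃⟫ ≤ −R, ‖p‖² − ⟪p, e₃⟫² ≤ ρ²}` and whose remaining balls lie in
`(fun p => A p + t) '' barlowStacking 1 √(2/3) σ` for one linear isometry `A`, translation `t` and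
Hägg sequence `σ`, satisfies `2 φ(e₃) π ρ² − C ρ ≤ 6N − numContacts x`. -/
theorem barlowGrain_noReconstructionGain_single_two :
    ∃ R C : ℝ, 0 < R ∧ ∀ ρ : ℝ, R ≤ ρ →
      ∀ (N : ℕ) (x : Fin N → EuclideanSpace ℝ (Fin 3)), IsUnitPacking x →
        (∀ p ∈ fccStacking 1 (Real.sqrt (2 / 3)),
          -(2 * R) ≤ ⟪p, EuclideanSpace.single (2 : Fin 3) (1 : ℝ)⟫_ℝ →
          ⟪p, EuclideanSpace.single (2 : Fin 3) (1 : ℝ)⟫_ℝ ≤ -R →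
          ‖p‖ ^ 2 - ⟪p, EuclideanSpace.single (2 : Fin 3) (1 : ℝ)⟫_ℝ ^ 2 ≤ ρ ^ 2 → ∃ i, x i = p) →
        (∃ (A : EuclideanSpace ℝ (Fin 3) ≃ₗᵢ[ℝ] EuclideanSpace ℝ (Fin 3))
            (t : EuclideanSpace ℝ (Fin 3)) (σ : ℤ → ℤ), IsHaggSeq σ ∧
            ∀ i, (x i ∈ fccStacking 1 (Real.sqrt (2 / 3)) ∧
                -(2 * R) ≤ ⟪x i, EuclideanSpace.single (2 : Fin 3) (1 : ℝ)⟫_ℝ ∧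
                ⟪x i, EuclideanSpace.single (2 : Fin 3) (1 : ℝ)⟫_ℝ ≤ -R ∧
                ‖x i‖ ^ 2 - ⟪x i, EuclideanSpace.single (2 : Fin 3) (1 : ℝ)⟫_ℝ ^ 2 ≤ ρ ^ 2) ∨
              x i ∈ (fun p => A p + t) '' barlowStacking 1 (Real.sqrt (2 / 3)) σ) →
        2 * (Real.sqrt 2 / 4 * ∑ᶠ w ∈ {w ∈ fccStacking 1 (Real.sqrt (2 / 3)) | ‖w‖ = 1},
              |⟪w, EuclideanSpace.single (2 : Fin 3) (1 : ℝ)⟫_ℝ|) * Real.pi * ρ ^ 2 - C * ρ ≤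
          6 * (N : ℝ) - (numContacts x : ℝ) := by
  classical
  obtain ⟨R, C₁, hR1, hadh⟩ := barlowGrainAdhesion111
  obtain ⟨C₂, hdef⟩ := stub_sampleDeficit R hR1
  refine ⟨R, C₁ + C₂, by linarith, ?_⟩
  intro ρ hρ N x hx hsample hgrain
  obtain ⟨A, t, σ, hσ, hballs⟩ := hgrain
  set e₃ : EuclideanSpace ℝ (Fin 3) := EuclideanSpace.single (2 : Fin 3) (1 : ℝ) with he₃
  have hν : ‖e₃‖ = 1 := by rw [he₃]; simp
  -- the packing as a finite set, the sample as a filter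
  have hxinj : Function.Injective x := hx.injective
  set X : Finset (EuclideanSpace ℝ (Fin 3)) := univ.image x with hX
  set P : Finset (EuclideanSpace ℝ (Fin 3)) := X.filter fun p =>
    p ∈ fccStacking 1 (Real.sqrt (2 / 3)) ∧ -(2 * R) ≤ ⟪p, e₃⟫_ℝ ∧ ⟪p, e₃⟫_ℝ ≤ -R ∧
      ‖p‖ ^ 2 - ⟪p, e₃⟫_ℝ ^ 2 ≤ ρ ^ 2 with hP
  have hXpack : ∀ p ∈ X, ∀ q ∈ X, p ≠ q → 1 ≤ dist p q := by
    intro p hp q hq hpq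
    obtain ⟨i, -, rfl⟩ := mem_image.1 hp
    obtain ⟨j, -, rfl⟩ := mem_image.1 hq
    exact hx.one_le_dist fun hij => hpq (by rw [hij])
  have hPX : P ⊆ X := filter_subset _ _
  have hPiff : ∀ p, p ∈ P ↔ (p ∈ fccStacking 1 (Real.sqrt (2 / 3)) ∧ -(2 * R) ≤ ⟪p, e₃⟫_ℝ ∧
      ⟪p, e₃⟫_ℝ ≤ -R ∧ ‖p‖ ^ 2 - ⟪p, e₃⟫_ℝ ^ 2 ≤ ρ ^ 2) := by
    intro p
    rw [hP, mem_filter]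
    refine ⟨fun h => h.2, fun h => ⟨?_, h⟩⟩
    obtain ⟨i, hi⟩ := hsample p h.1 h.2.1 h.2.2.1 h.2.2.2
    exact mem_image.2 ⟨i, mem_univ _, hi⟩
  -- the non-sample balls lie in the grain
  have hQ : (↑(X \ P) : Set (EuclideanSpace ℝ (Fin 3))) ⊆
      (fun p => A p + t) '' barlowStacking 1 (Real.sqrt (2 / 3)) σ := by
    intro q hq
    rw [mem_coe, mem_sdiff] at hq
    obtain ⟨hqX, hqP⟩ := hq
    obtain ⟨i, -, rfl⟩ := mem_image.1 hqX
    rcases hballs i with h | h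
    · exact absurd ((hPiff (x i)).2 h) hqP
    · exact h
  have h1 := hadh ρ hρ X P hXpack hPX hPiff ⟨A, t, σ, hσ, hQ⟩
  have h2 := hdef e₃ hν ρ hρ P hPiff
  have hsplit := contactDeficiency_sdiff_split hPX
  have hDX : contactDeficiency X = 6 * (N : ℝ) - (numContacts x : ℝ) :=
    contactDeficiency_image_eq x hxinj
  rw [← hDX]
  nlinarith [h1, h2, hsplit, (by linarith : (0 : ℝ) ≤ ρ)]

/-- **Numerical form**: with `φ(e₃) = √3` (`phiFcc_single_two`), under the same hypotheses
`2 √3 π ρ² − C ρ ≤ 6N − numContacts x`. -/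
theorem barlowGrain_noReconstructionGain_single_two_sqrt3 :
    ∃ R C : ℝ, 0 < R ∧ ∀ ρ : ℝ, R ≤ ρ →
      ∀ (N : ℕ) (x : Fin N → EuclideanSpace ℝ (Fin 3)), IsUnitPacking x →
        (∀ p ∈ fccStacking 1 (Real.sqrt (2 / 3)),
          -(2 * R) ≤ ⟪p, EuclideanSpace.single (2 : Fin 3) (1 : ℝ)⟫_ℝ →
          ⟪p, EuclideanSpace.single (2 : Fin 3) (1 : ℝ)⟫_ℝ ≤ -R →
          ‖p‖ ^ 2 - ⟪p, EuclideanSpace.single (2 : Fin 3) (1 : ℝ)⟫_ℝ ^ 2 ≤ ρ ^ 2 → ∃ i, x i = p) →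
        (∃ (A : EuclideanSpace ℝ (Fin 3) ≃ₗᵢ[ℝ] EuclideanSpace ℝ (Fin 3))
            (t : EuclideanSpace ℝ (Fin 3)) (σ : ℤ → ℤ), IsHaggSeq σ ∧
            ∀ i, (x i ∈ fccStacking 1 (Real.sqrt (2 / 3)) ∧
                -(2 * R) ≤ ⟪x i, EuclideanSpace.single (2 : Fin 3) (1 : ℝ)⟫_ℝ ∧
                ⟪x i, EuclideanSpace.single (2 : Fin 3) (1 : ℝ)⟫_ℝ ≤ -R ∧
                ‖x i‖ ^ 2 - ⟪x i, EuclideanSpace.single (2 : Fin 3) (1 : ℝ)⟫_ℝ ^ 2 ≤ ρ ^ 2) ∨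
              x i ∈ (fun p => A p + t) '' barlowStacking 1 (Real.sqrt (2 / 3)) σ) →
        2 * Real.sqrt 3 * Real.pi * ρ ^ 2 - C * ρ ≤ 6 * (N : ℝ) - (numContacts x : ℝ) := by
  obtain ⟨R, C, hR, h⟩ := barlowGrain_noReconstructionGain_single_two
  refine ⟨R, C, hR, fun ρ hρ N x hx hsample hgrain => ?_⟩
  have := h ρ hρ N x hx hsample hgrain
  rw [phiFcc_single_two] at this
  exact this

end Summit.Ventures.Crystal3D.Theorems

end
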